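import Summits.CriticalPhenomena.PercolationContinuityZ3.Theorems.PercNearOneGluingNoHeavyLowerTailSunflowerPiercedPairKernelB
import Summits.CriticalPhenomena.PercolationContinuityZ3.Theorems.PercNearOneGluingNoHeavyLowerTailSunflowerPrincipalPetal
import HarnessLib

/-!
# `NoHeavyLowerTail` (crux stmt-CriticalPhenomena-4575), abstract sunflower cubic: ★ (`0 ≤ ZH`) behind a PIERCED PAIR — a pair
# `{s,t}` lying in one petal's up-set that meets every set of the other two petals

Support file (seat `prim-ineq-gen-2` gen 23; `--supports stmt-CriticalPhenomena-4575`).  No `sorry`, no named facts; nothing is asserted about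
the crux.  Assembly of the kernel checks `…SunflowerPiercedPairKernel` (first shape) and `…SunflowerPiercedPairKernelB` (second shape).  Memo: run/shared/lean/prim/prim-ineq-gen-2/gen23/CLUB-ORPETAL-ALL-R.md §8.

THEOREM `Sunflower.ZH_nonneg_of_nonbottom_pair_piercing_two_petals` (this work; a new unconditional class of the typed conjecture
`PartitionLemmaH` = ★): if two points `s ≠ t` form a NON-BOTTOM pair (`lab {s,t} ≠ 0`) and there is a petal label `m` such that every set whose
label is a petal label other than `m` meets `{s,t}` (the pair PIERCES the two petals `≠ m`), then `0 ≤ ZH`.  Two shapes after relabelling: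
the pair lies in `V_ℓ` and pierces the two other petals (`ZH_nonneg_of_piercedPair_one`, kernel `…PiercedPairKernel`), or it lies in `V_ℓ` and
pierces petal `ℓ` and one more (`ZH_nonneg_of_piercedPair_two`, kernel `…PiercedPairKernelB`); all label positions by the petal rotation
`rotate` (tree) and the petal transposition `swap23` (here).  The class is not contained in the intersecting / centred / no-disjoint-kernel-pair / cross-intersecting /
disjunctive-petal / non-bottom-singleton classes (6-point member with two rainbows in the memo); it was FOUND by an LP scan over all two-point
hypotheses (kit j160692–j160817): among hypotheses constraining only the traces on `K = {s,t}` it is, with its companion "`K ∈ V_ℓ` and petals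
`ℓ`, `j` pierced" (certified, not formalised here), the only new pointwise-certifiable one.

PROOF (architecture of `…SpectatorTransferOrPetalPair`).  Split the ordered 3-partitions of `α` by the blocks receiving `s` and `t`
(`nested_insert_split` twice): `ZH` becomes a nested sum over the 3-partitions `(X,S,T)` of `E' = univ ∖ {s,t}` of the nine-placement kernel
`nineH` of the BLOCK DATA `(lab X, lab (X+s), lab (X+t), lab (X+s+t))`, which under the hypotheses takes 35 values (`ppCode`).  Subtract the two
CONTRACTION ROWS — antipodal Gladkov for the sections `lab (· + s)`, `lab (· + t)` on the window `E' ∖ X` (`antipodal_gladkov_polarized` with equal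
offsets; `nested_weight_mul_kk_insert_nonneg`) with weights `wS`, `wT ∈ {0,3,6}` of the first block — and symmetrise (`six_mul_nested_eq_symm6Of`):
the symmetrised kernel is nonnegative on every code triple (`ppKer_symm_nonneg`, from the sorted check by symmetry of `symm6Of`).
-/

namespace Summit.CriticalPhenomena.PercolationContinuityZ3.Theorems.SunflowerPartition

open Finset

/-- `symm6Of` is symmetric in its first two arguments. [this work] -/
theorem symm6Of_swap12 {β : Type*} (g : β → β → β → ℤ) (x y z : β) : symm6Of g x y z = symm6Of g y x z := by
  unfold symm6Of; ring

/-- `symm6Of` is symmetric in its last two arguments. [this work] -/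
theorem symm6Of_swap23 {β : Type*} (g : β → β → β → ℤ) (x y z : β) : symm6Of g x y z = symm6Of g x z y := by
  unfold symm6Of; ring

/-- **Finite kernel check**: the symmetrised kernel is nonnegative on all `35³` code triples. [this work] -/
theorem ppKer_symm_nonneg (a b c : Fin 35) : 0 ≤ symm6Of ppKer (ppCode a) (ppCode b) (ppCode c) := by
  have S := ppKer_symm_nonneg_sorted
  have P12 := fun x y z : Fin 35 => symm6Of_swap12 ppKer (ppCode x) (ppCode y) (ppCode z)
  have P23 := fun x y z : Fin 35 => symm6Of_swap23 ppKer (ppCode x) (ppCode y) (ppCode z)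
  rcases le_total a b with hab | hba <;> rcases le_total b c with hbc | hcb <;> rcases le_total a c with hac | hca
  · exact S a b c hab hbc
  · exact S a b c hab hbc
  · rw [P23]; exact S a c b hac hcb
  · rw [P23, P12]; exact S c a b hca hab
  · rw [P12]; exact S b a c hba hac
  · rw [P12, P23]; exact S b c a hbc hca
  · rw [P12, P23, P12]; exact S c b a hcb hba
  · rw [P12, P23, P12]; exact S c b a hcb hba

/-- Admissibility of block data behind a pierced pair in normal form, as a Boolean test. [this work] -/
def ppAdm (x xs xt xst : Fin 5) : Bool :=
  (x = 0 || x = 1 || x = 4) && (xst = 1 || xst = 4) &&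
    (x = xs || x = 0 || xs = 4) && (x = xt || x = 0 || xt = 4) && (xs = xst || xs = 0 || xst = 4) && (xt = xst || xt = 0 || xst = 4)

/-- Every admissible block-data quadruple is one of the 35 codes. [this work] -/
theorem exists_ppCode_of : ∀ x xs xt xst : Fin 5, ppAdm x xs xt xst = true → ∃ c : Fin 35, ppCode c = (x, xs, xt, xst) := by
  decide

/-! ## The theorem -/

variable {α : Type*} [DecidableEq α]

namespace Sunflower

variable (F : Sunflower α)

/-- Contraction rows with a nonnegative weight of the first block are nonnegative (polarised antipodal Gladkov with equal offsets `{e}`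
on every complement cube). [this work] -/
theorem nested_weight_mul_kk_insert_nonneg (W : Finset α) (e : α) (w : Finset α → ℤ) (hw : ∀ X, 0 ≤ w X) :
    0 ≤ nested W (fun X S T => w X * kk (F.lab (insert e S)) (F.lab (insert e T))) := by
  unfold nested
  refine sum_nonneg fun X _ => ?_
  rw [← mul_sum]
  refine mul_nonneg (hw X) ?_
  have h := F.antipodal_gladkov_polarized (W \ X) {e} {e} subset_rfl
  refine le_of_le_of_eq h (sum_congr rfl fun S _ => ?_)
  rw [← insert_eq, ← insert_eq]

/-- Behind a pierced pair in normal form (`lab {s,t} ∈ {1,4}`, every set of label `2` or `3` meets `{s,t}`), the block data of a set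
avoiding `s,t` is one of the 35 codes. [this work] -/
theorem exists_ppCode {s t : α} (hK : F.lab {s, t} = 1 ∨ F.lab {s, t} = 4)
    (hP : ∀ S : Finset α, F.lab S = 2 ∨ F.lab S = 3 → (S ∩ {s, t}).Nonempty) {X : Finset α} (hs : s ∉ X) (ht : t ∉ X) :
    ∃ c : Fin 35, ppCode c = F.blockData s t X := by
  unfold blockData
  have x23 : F.lab X = 0 ∨ F.lab X = 1 ∨ F.lab X = 4 := by
    have hn : ¬ (F.lab X = 2 ∨ F.lab X = 3) := by
      intro h23
      obtain ⟨x, hx⟩ := hP X h23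
      rw [mem_inter, mem_insert, mem_singleton] at hx
      rcases hx.2 with rfl | rfl
      · exact hs hx.1
      · exact ht hx.1
    revert hn; generalize F.lab X = v; revert v; decide
  have top : F.lab (insert s (insert t X)) = 1 ∨ F.lab (insert s (insert t X)) = 4 := by
    have hsub : ({s, t} : Finset α) ⊆ insert s (insert t X) :=
      insert_subset (mem_insert_self _ _) (singleton_subset_iff.2 (mem_insert_of_mem (mem_insert_self _ _)))
    have m := F.lab_mono hsub
    revert m hK; generalize F.lab {s, t} = u; generalize F.lab (insert s (insert t X)) = v; revert u v; decide
  have m1 := F.lab_mono (subset_insert s X)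
  have m2 := F.lab_mono (subset_insert t X)
  have m3 := F.lab_mono (insert_subset_insert s (subset_insert t X))
  have m4 := F.lab_mono (subset_insert s (insert t X))
  refine exists_ppCode_of _ _ _ _ ?_
  simp only [ppAdm, Bool.and_eq_true, Bool.or_eq_true, decide_eq_true_eq, or_assoc]
  exact ⟨⟨⟨⟨⟨x23, top⟩, m1⟩, m2⟩, m3⟩, m4⟩

/-- **★ behind a pierced pair, normal form**: if `lab {s,t} ∈ {1,4}` (`s ≠ t`) and every set of label `2` or `3` meets `{s,t}`, then
`0 ≤ ZH`. [this work] -/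
theorem ZH_nonneg_of_piercedPair_one [Fintype α] {s t : α} (hst : s ≠ t) (hK : F.lab {s, t} = 1 ∨ F.lab {s, t} = 4)
    (hP : ∀ S : Finset α, F.lab S = 2 ∨ F.lab S = 3 → (S ∩ {s, t}).Nonempty) : 0 ≤ F.ZH := by
  set E' : Finset α := univ \ {s, t} with hE'
  have hsE : s ∉ E' := fun hh => (mem_sdiff.1 hh).2 (mem_insert_self _ _)
  have htE : t ∉ E' := fun hh => (mem_sdiff.1 hh).2 (mem_insert_of_mem (mem_singleton_self _))
  have hsW : s ∉ insert t E' := fun hh => by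
    rcases mem_insert.1 hh with hh | hh
    · exact hst hh
    · exact hsE hh
  have huniv : (univ : Finset α) = insert s (insert t E') := by
    ext x
    simp only [mem_univ, mem_insert, hE', mem_sdiff, mem_singleton, true_and, true_iff]
    tauto
  set G : Finset α → Finset α → Finset α → ℤ := fun X S T => s6H (F.lab X) (F.lab S) (F.lab T) with hG
  set L : Finset α → BlockData := F.blockData s t with hL
  -- ZH as a nested sum on `insert s (insert t E')`, split along `s` and `t`: nine placements minus the rows, plus the rows
  have hsplit : nested (insert s (insert t E')) G
      = nested E' (fun X S T => ppKer (L X) (L S) (L T))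
        + (nested E' (fun X S T => wS (L X) * kk (F.lab (insert s S)) (F.lab (insert s T)))
          + nested E' (fun X S T => wT (L X) * kk (F.lab (insert t S)) (F.lab (insert t T)))) := by
    rw [nested_insert_split _ s hsW, nested_insert_split _ t htE, nested_insert_split _ t htE, nested_insert_split _ t htE]
    unfold nested
    simp only [hG, hL, blockData, ppKer, nineH, sum_add_distrib, sum_sub_distrib]
    ring
  have hker : 0 ≤ nested E' (fun X S T => ppKer (L X) (L S) (L T)) := by
    have h6 := six_mul_nested_eq_symm6Of E' L ppKer
    have hpos : 0 ≤ nested E' (fun X S T => symm6Of ppKer (L X) (L S) (L T)) := by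
      refine nested_nonneg_of_forall E' _ fun X hX S hS => ?_
      have hT : (E' \ X) \ S ⊆ E' := sdiff_subset.trans sdiff_subset
      have hS' : S ⊆ E' := hS.trans sdiff_subset
      obtain ⟨a, ha⟩ := F.exists_ppCode hK hP (fun hh => hsE (hX hh)) (fun hh => htE (hX hh))
      obtain ⟨b, hb⟩ := F.exists_ppCode hK hP (fun hh => hsE (hS' hh)) (fun hh => htE (hS' hh))
      obtain ⟨c, hc⟩ := F.exists_ppCode hK hP (fun hh => hsE (hT hh)) (fun hh => htE (hT hh))
      rw [hL, ← ha, ← hb, ← hc]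
      exact ppKer_symm_nonneg a b c
    linarith
  have hrowS : 0 ≤ nested E' (fun X S T => wS (L X) * kk (F.lab (insert s S)) (F.lab (insert s T))) :=
    F.nested_weight_mul_kk_insert_nonneg E' s (fun X => wS (L X)) fun X => wS_nonneg _
  have hrowT : 0 ≤ nested E' (fun X S T => wT (L X) * kk (F.lab (insert t S)) (F.lab (insert t T))) :=
    F.nested_weight_mul_kk_insert_nonneg E' t (fun X => wT (L X)) fun X => wT_nonneg _
  have hZ : F.ZH = nested (insert s (insert t E')) G := by
    unfold ZH
    rw [sum_parts_eq_nested_univ (fun X S T => s6H (F.lab X) (F.lab S) (F.lab T)), huniv]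
  rw [hZ, hsplit]
  linarith

/-! ### Second shape: the pair lies in `V_1` and pierces petals `1` and `3` -/

/-- Admissibility of block data, second shape. [this work] -/
def _root_.Summit.CriticalPhenomena.PercolationContinuityZ3.Theorems.SunflowerPartition.pp2Adm (x xs xt xst : Fin 5) : Bool :=
  (x = 0 || x = 2 || x = 4) && (xst = 1 || xst = 4) &&
    (x = xs || x = 0 || xs = 4) && (x = xt || x = 0 || xt = 4) && (xs = xst || xs = 0 || xst = 4) && (xt = xst || xt = 0 || xst = 4)

/-- Every admissible block-data quadruple of the second shape is one of the 34 codes. [this work] -/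
theorem _root_.Summit.CriticalPhenomena.PercolationContinuityZ3.Theorems.SunflowerPartition.exists_pp2Code_of : ∀ x xs xt xst : Fin 5, pp2Adm x xs xt xst = true →
    ∃ c : Fin 34, pp2Code c = (x, xs, xt, xst) := by
  decide

/-- **Finite kernel check, second shape**: the symmetrised doubled kernel is nonnegative on all `34³` code triples. [this work] -/
theorem _root_.Summit.CriticalPhenomena.PercolationContinuityZ3.Theorems.SunflowerPartition.pp2Ker_symm_nonneg (a b c : Fin 34) : 0 ≤ symm6Of pp2Ker (pp2Code a) (pp2Code b) (pp2Code c) := by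
  have S := pp2Ker_symm_nonneg_sorted
  have P12 := fun x y z : Fin 34 => symm6Of_swap12 pp2Ker (pp2Code x) (pp2Code y) (pp2Code z)
  have P23 := fun x y z : Fin 34 => symm6Of_swap23 pp2Ker (pp2Code x) (pp2Code y) (pp2Code z)
  rcases le_total a b with hab | hba <;> rcases le_total b c with hbc | hcb <;> rcases le_total a c with hac | hca
  · exact S a b c hab hbc
  · exact S a b c hab hbc
  · rw [P23]; exact S a c b hac hcb
  · rw [P23, P12]; exact S c a b hca hab
  · rw [P12]; exact S b a c hba hac
  · rw [P12, P23]; exact S b c a hbc hca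
  · rw [P12, P23, P12]; exact S c b a hcb hba
  · rw [P12, P23, P12]; exact S c b a hcb hba

/-- Behind a pierced pair of the second shape (`lab {s,t} ∈ {1,4}`, every set of label `1` or `3` meets `{s,t}`), the block data of a set
avoiding `s,t` is one of the 34 codes. [this work] -/
theorem exists_pp2Code {s t : α} (hK : F.lab {s, t} = 1 ∨ F.lab {s, t} = 4)
    (hP : ∀ S : Finset α, F.lab S = 1 ∨ F.lab S = 3 → (S ∩ {s, t}).Nonempty) {X : Finset α} (hs : s ∉ X) (ht : t ∉ X) :
    ∃ c : Fin 34, pp2Code c = F.blockData s t X := by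
  unfold blockData
  have x13 : F.lab X = 0 ∨ F.lab X = 2 ∨ F.lab X = 4 := by
    have hn : ¬ (F.lab X = 1 ∨ F.lab X = 3) := by
      intro h13
      obtain ⟨x, hx⟩ := hP X h13
      rw [mem_inter, mem_insert, mem_singleton] at hx
      rcases hx.2 with rfl | rfl
      · exact hs hx.1
      · exact ht hx.1
    revert hn; generalize F.lab X = v; revert v; decide
  have top : F.lab (insert s (insert t X)) = 1 ∨ F.lab (insert s (insert t X)) = 4 := by
    have hsub : ({s, t} : Finset α) ⊆ insert s (insert t X) :=
      insert_subset (mem_insert_self _ _) (singleton_subset_iff.2 (mem_insert_of_mem (mem_insert_self _ _)))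
    have m := F.lab_mono hsub
    revert m hK; generalize F.lab {s, t} = u; generalize F.lab (insert s (insert t X)) = v; revert u v; decide
  have m1 := F.lab_mono (subset_insert s X)
  have m2 := F.lab_mono (subset_insert t X)
  have m3 := F.lab_mono (insert_subset_insert s (subset_insert t X))
  have m4 := F.lab_mono (subset_insert s (insert t X))
  refine exists_pp2Code_of _ _ _ _ ?_
  simp only [pp2Adm, Bool.and_eq_true, Bool.or_eq_true, decide_eq_true_eq, or_assoc]
  exact ⟨⟨⟨⟨⟨x13, top⟩, m1⟩, m2⟩, m3⟩, m4⟩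

/-- **★ behind a pierced pair, second normal form**: if `lab {s,t} ∈ {1,4}` (`s ≠ t`) and every set of label `1` or `3` meets `{s,t}`,
then `0 ≤ ZH`. [this work] -/
theorem ZH_nonneg_of_piercedPair_two [Fintype α] {s t : α} (hst : s ≠ t) (hK : F.lab {s, t} = 1 ∨ F.lab {s, t} = 4)
    (hP : ∀ S : Finset α, F.lab S = 1 ∨ F.lab S = 3 → (S ∩ {s, t}).Nonempty) : 0 ≤ F.ZH := by
  set E' : Finset α := univ \ {s, t} with hE'
  have hsE : s ∉ E' := fun hh => (mem_sdiff.1 hh).2 (mem_insert_self _ _)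
  have htE : t ∉ E' := fun hh => (mem_sdiff.1 hh).2 (mem_insert_of_mem (mem_singleton_self _))
  have hsW : s ∉ insert t E' := fun hh => by
    rcases mem_insert.1 hh with hh | hh
    · exact hst hh
    · exact hsE hh
  have huniv : (univ : Finset α) = insert s (insert t E') := by
    ext x
    simp only [mem_univ, mem_insert, hE', mem_sdiff, mem_singleton, true_and, true_iff]
    tauto
  set G : Finset α → Finset α → Finset α → ℤ := fun X S T => s6H (F.lab X) (F.lab S) (F.lab T) with hG
  set L : Finset α → BlockData := F.blockData s t with hL
  have hsplit : 2 * nested (insert s (insert t E')) G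
      = nested E' (fun X S T => pp2Ker (L X) (L S) (L T))
        + (nested E' (fun X S T => w2S (L X).1 (L X).2.1 (L X).2.2.1 * kk (F.lab (insert s S)) (F.lab (insert s T)))
          + nested E' (fun X S T => w2T (L X).1 (L X).2.1 (L X).2.2.1 * kk (F.lab (insert t S)) (F.lab (insert t T)))) := by
    rw [nested_insert_split _ s hsW, nested_insert_split _ t htE, nested_insert_split _ t htE, nested_insert_split _ t htE]
    unfold nested
    simp only [hG, hL, blockData, pp2Ker, nineH, sum_add_distrib, sum_sub_distrib, two_mul]
    ring
  have hker : 0 ≤ nested E' (fun X S T => pp2Ker (L X) (L S) (L T)) := by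
    have h6 := six_mul_nested_eq_symm6Of E' L pp2Ker
    have hpos : 0 ≤ nested E' (fun X S T => symm6Of pp2Ker (L X) (L S) (L T)) := by
      refine nested_nonneg_of_forall E' _ fun X hX S hS => ?_
      have hT : (E' \ X) \ S ⊆ E' := sdiff_subset.trans sdiff_subset
      have hS' : S ⊆ E' := hS.trans sdiff_subset
      obtain ⟨a, ha⟩ := F.exists_pp2Code hK hP (fun hh => hsE (hX hh)) (fun hh => htE (hX hh))
      obtain ⟨b, hb⟩ := F.exists_pp2Code hK hP (fun hh => hsE (hS' hh)) (fun hh => htE (hS' hh))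
      obtain ⟨c, hc⟩ := F.exists_pp2Code hK hP (fun hh => hsE (hT hh)) (fun hh => htE (hT hh))
      rw [hL, ← ha, ← hb, ← hc]
      exact pp2Ker_symm_nonneg a b c
    linarith
  have hrowS : 0 ≤ nested E' (fun X S T => w2S (L X).1 (L X).2.1 (L X).2.2.1 * kk (F.lab (insert s S)) (F.lab (insert s T))) :=
    F.nested_weight_mul_kk_insert_nonneg E' s (fun X => w2S (L X).1 (L X).2.1 (L X).2.2.1) fun X => w2S_nonneg _ _ _
  have hrowT : 0 ≤ nested E' (fun X S T => w2T (L X).1 (L X).2.1 (L X).2.2.1 * kk (F.lab (insert t S)) (F.lab (insert t T))) :=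
    F.nested_weight_mul_kk_insert_nonneg E' t (fun X => w2T (L X).1 (L X).2.1 (L X).2.2.1) fun X => w2T_nonneg _ _ _
  have hZ : F.ZH = nested (insert s (insert t E')) G := by
    unfold ZH
    rw [sum_parts_eq_nested_univ (fun X S T => s6H (F.lab X) (F.lab S) (F.lab T)), huniv]
  have h2 : 0 ≤ 2 * F.ZH := by rw [hZ, hsplit]; linarith
  linarith

/-! ### The petal transposition `2 ↔ 3` -/

/-- Exchanging the petals `2` and `3`: `V' = (V 0, V 2, V 1)`. [this work] -/
def swap23 : Sunflower α where
  V := ![F.V 0, F.V 2, F.V 1]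
  upper := by
    intro i
    fin_cases i
    · exact F.upper 0
    · exact F.upper 2
    · exact F.upper 1
  inter_eq := by
    have hA : ∀ a b : Fin 3, a ≠ b → F.V a ∩ F.V b = F.V 0 ∩ F.V 2 := fun a b h => by
      rw [F.inter_eq a b h, F.inter_eq 0 2 (by decide)]
    intro i j hij
    fin_cases i <;> fin_cases j
    all_goals (first | exact absurd rfl hij | exact hA _ _ (by decide))

/-- The components of `swap23`. [this work] -/
theorem swap23_V : F.swap23.V 0 = F.V 0 ∧ F.swap23.V 1 = F.V 2 ∧ F.swap23.V 2 = F.V 1 := ⟨rfl, rfl, rfl⟩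

/-- The kernel is unchanged by `swap23`. [this work] -/
theorem swap23_A : F.swap23.A = F.A := by
  show F.V 0 ∩ F.V 2 = F.V 0 ∩ F.V 1
  rw [F.inter_eq 0 2 (by decide)]

/-- The induced permutation of `M₃`: `2 ↔ 3`. [this work] -/
def _root_.Summit.CriticalPhenomena.PercolationContinuityZ3.Theorems.SunflowerPartition.sw5 : Fin 5 → Fin 5 := ![0, 1, 3, 2, 4]

/-- Labels of the transposed sunflower. [this work] -/
theorem lab_swap23 (S : Finset α) : F.swap23.lab S = sw5 (F.lab S) := by
  by_cases hA : S ∈ F.A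
  · have h1 : F.swap23.lab S = 4 := (F.swap23.lab_eq_four_iff S).2 (by rw [swap23_A]; exact hA)
    have h2 : F.lab S = 4 := (F.lab_eq_four_iff S).2 hA
    rw [h1, h2]; rfl
  have hA' : S ∉ F.swap23.A := by rw [swap23_A]; exact hA
  have n4 : F.lab S ≠ 4 := fun h => hA ((F.lab_eq_four_iff S).1 h)
  have n4' : F.swap23.lab S ≠ 4 := fun h => hA' ((F.swap23.lab_eq_four_iff S).1 h)
  by_cases h0 : S ∈ F.V 0
  · have h1 : F.lab S = 1 := ((F.lab_V0_iff S).2 h0).resolve_right n4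
    have h2 : F.swap23.lab S = 1 := ((F.swap23.lab_V0_iff S).2 (by rw [F.swap23_V.1]; exact h0)).resolve_right n4'
    rw [h1, h2]; rfl
  by_cases h1 : S ∈ F.V 1
  · have e1 : F.lab S = 2 := ((F.lab_V1_iff S).2 h1).resolve_right n4
    have e2 : F.swap23.lab S = 3 := ((F.swap23.lab_V2_iff S).2 (by rw [F.swap23_V.2.2]; exact h1)).resolve_right n4'
    rw [e1, e2]; rfl
  by_cases h2 : S ∈ F.V 2
  · have e1 : F.lab S = 3 := ((F.lab_V2_iff S).2 h2).resolve_right n4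
    have e2 : F.swap23.lab S = 2 := ((F.swap23.lab_V1_iff S).2 (by rw [F.swap23_V.2.1]; exact h2)).resolve_right n4'
    rw [e1, e2]; rfl
  · have e1 : F.lab S = 0 := by
      unfold Sunflower.lab; rw [if_neg hA, if_neg h0, if_neg h1, if_neg h2]
    have e2 : F.swap23.lab S = 0 := by
      have h0' : S ∉ F.swap23.V 0 := by rw [F.swap23_V.1]; exact h0
      have h1' : S ∉ F.swap23.V 1 := by rw [F.swap23_V.2.1]; exact h2
      have h2' : S ∉ F.swap23.V 2 := by rw [F.swap23_V.2.2]; exact h1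
      unfold Sunflower.lab; rw [if_neg hA', if_neg h0', if_neg h1', if_neg h2']
    rw [e1, e2]; rfl

/-- `s6H` is invariant under the petal transposition. [this work] -/
theorem _root_.Summit.CriticalPhenomena.PercolationContinuityZ3.Theorems.SunflowerPartition.s6H_sw5 : ∀ x y z : Fin 5, s6H (sw5 x) (sw5 y) (sw5 z) = s6H x y z := by decide

/-- `ZH` is invariant under the petal transposition. [this work] -/
theorem swap23_ZH [Fintype α] : F.swap23.ZH = F.ZH := by
  unfold ZH
  refine sum_congr rfl fun q _ => ?_
  rw [F.lab_swap23, F.lab_swap23, F.lab_swap23, s6H_sw5]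

/-! ### Assembly over all label positions -/

/-- Both normal forms at once: `lab {s,t} ∈ {1,4}` and, for `m ∈ {1,2,3}`, every set with a petal label `≠ m` meets `{s,t}`. [this work] -/
theorem ZH_nonneg_of_piercedPair_label_one [Fintype α] {s t : α} (hst : s ≠ t) (hK : F.lab {s, t} = 1 ∨ F.lab {s, t} = 4)
    (m : Fin 5) (hm : m = 1 ∨ m = 2 ∨ m = 3)
    (hP : ∀ S : Finset α, F.lab S ≠ 0 → F.lab S ≠ 4 → F.lab S ≠ m → (S ∩ {s, t}).Nonempty) : 0 ≤ F.ZH := by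
  rcases hm with rfl | rfl | rfl
  · exact F.ZH_nonneg_of_piercedPair_one hst hK fun S hS => hP S (by rcases hS with e | e <;> rw [e] <;> decide)
      (by rcases hS with e | e <;> rw [e] <;> decide) (by rcases hS with e | e <;> rw [e] <;> decide)
  · exact F.ZH_nonneg_of_piercedPair_two hst hK fun S hS => hP S (by rcases hS with e | e <;> rw [e] <;> decide)
      (by rcases hS with e | e <;> rw [e] <;> decide) (by rcases hS with e | e <;> rw [e] <;> decide)
  · -- `m = 3`: transpose the petals `2 ↔ 3`
    rw [← F.swap23_ZH]
    refine F.swap23.ZH_nonneg_of_piercedPair_two hst ?_ fun S hS => hP S ?_ ?_ ?_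
    · rw [F.lab_swap23]
      rcases hK with e | e <;> rw [e] <;> decide
    all_goals rw [F.lab_swap23] at hS; revert hS; generalize F.lab S = x; revert x; decide

/-- **★ BEHIND A NON-BOTTOM PAIR PIERCING TWO PETALS**: if `s ≠ t`, the pair `{s,t}` is not bottom (`lab {s,t} ≠ 0`), and for some petal
label `m` every set carrying a petal label other than `m` meets `{s,t}`, then `0 ≤ ZH`. [this work] -/
theorem ZH_nonneg_of_nonbottom_pair_piercing_two_petals [Fintype α] {s t : α} (hst : s ≠ t) (hK : F.lab {s, t} ≠ 0)
    (m : Fin 5) (hm : m = 1 ∨ m = 2 ∨ m = 3)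
    (hP : ∀ S : Finset α, F.lab S ≠ 0 → F.lab S ≠ 4 → F.lab S ≠ m → (S ∩ {s, t}).Nonempty) : 0 ≤ F.ZH := by
  -- the label of the pair is `1`, `2`, `3` or `4`; rotate so that it becomes `1` (or stays `4`)
  have hcases : F.lab {s, t} = 1 ∨ F.lab {s, t} = 4 ∨ F.lab {s, t} = 2 ∨ F.lab {s, t} = 3 := by
    revert hK; generalize F.lab {s, t} = v; revert v; decide
  rcases hcases with h1 | h4 | h2 | h3
  · exact F.ZH_nonneg_of_piercedPair_label_one hst (Or.inl h1) m hm hP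
  · exact F.ZH_nonneg_of_piercedPair_label_one hst (Or.inr h4) m hm hP
  · -- label `2`: one rotation (`rot5 2 = 1`), `m ↦ rot5 m`
    rw [← F.rotate_ZH]
    refine F.rotate.ZH_nonneg_of_piercedPair_label_one hst ?_ (rot5 m) ?_ fun S hS0 hS4 hSm => hP S ?_ ?_ ?_
    · rw [F.lab_rotate, h2]; decide
    · rcases hm with rfl | rfl | rfl <;> decide
    · rw [F.lab_rotate] at hS0; revert hS0; generalize F.lab S = x; revert x; decide
    · rw [F.lab_rotate] at hS4; revert hS4; generalize F.lab S = x; revert x; decide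
    · rw [F.lab_rotate] at hSm; intro he; exact hSm (by rw [he])
  · -- label `3`: two rotations (`rot5 (rot5 3) = 1`)
    rw [← F.rotate_ZH, ← F.rotate.rotate_ZH]
    refine F.rotate.rotate.ZH_nonneg_of_piercedPair_label_one hst ?_ (rot5 (rot5 m)) ?_ fun S hS0 hS4 hSm => hP S ?_ ?_ ?_
    · rw [F.rotate.lab_rotate, F.lab_rotate, h3]; decide
    · rcases hm with rfl | rfl | rfl <;> decide
    · rw [F.rotate.lab_rotate, F.lab_rotate] at hS0; revert hS0; generalize F.lab S = x; revert x; decide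
    · rw [F.rotate.lab_rotate, F.lab_rotate] at hS4; revert hS4; generalize F.lab S = x; revert x; decide
    · rw [F.rotate.lab_rotate, F.lab_rotate] at hSm; intro he; exact hSm (by rw [he])

end Sunflower

end Summit.CriticalPhenomena.PercolationContinuityZ3.Theorems.SunflowerPartition
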